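import Summits.HodgeConjecture.CorCM.IrreducibleOddWeightsOrbital
import Summits.HodgeConjecture.CorCM.IrreducibleOddWeightsDichotomy
import HarnessLib

/-!
# Wielandt's expansion for the odd weights: every odd-valued equivariant endomorphism is a combination of the
# projection and the orbital operators (`d = 1 + p`); with ONE non-self-conjugate orbit pair, (IRR) ⟺ the orbital
# operator has no rational eigenvector

COR-CM (cell `pub-hodgecm2`, binder seat `b16` gen 55, count-neutral claim IRR-ODD, file F7 — abstract `G`-set level,
sequel of F3 `CorCM/IrreducibleOddWeightsOrbital` and F5 `CorCM/IrreducibleOddWeightsDichotomy`; theorems only, no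
definition, no named fact, no `sorry`).  NEW as stated, hence under `Summits/`.  HONEST FRAMING: finite-dimensional
linear algebra (Wielandt's centraliser-algebra count, odd part); `HC_CM` is neither used nor asserted.

Setting: `G` transitive on `X`, `ρ ∈ G` a central fixed-point-free involution, `x₀ ∈ X`, points `y_1, …, y_p ∉ {x₀, ρx₀}`
in `p` different NON-SELF-CONJUGATE orbit pairs of `Stab(x₀)` which, together with the self-conjugate orbits, COVER
`X ∖ {x₀, ρx₀}` (`hcover`), and the orbital operators `T_j` of F3 (`T_j δ_{x₀} = 𝟙_{Stab(x₀)y_j} − 𝟙_{ρStab(x₀)y_j}`).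

* §1 **`exists_coeffs_of_odd_equivariant`** — WIELANDT'S EXPANSION: every `G`-equivariant endomorphism `S` of `ℚ^X`
  with `ρ`-odd values is `S = c₀·P + Σ_j c_j·T_j`, `P f = f − f∘ρ`, with `c₀ = (Sδ_{x₀})(x₀)`, `c_j = (Sδ_{x₀})(y_j)`
  (`Sδ_{x₀}` is a `Stab(x₀)`-invariant odd function: it vanishes on self-conjugate orbits and is constant on the others;
  transitivity carries the identity from `δ_{x₀}` to every `δ_y`).  With F3 (`P, T_1, …, T_p` independent on `Anti`) the
  commutant of the odd weights has dimension EXACTLY `d = 1 + p` — the odd half of Wielandt's "rank = number of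
  suborbits".
* §2 **`irreducible_iff_forall_eigen`** — ONE non-self-conjugate orbit pair (`p = 1`, the generic non-(SC) situation:
  six of the eight octic Galois types with (IRR) ∧ ¬(SC)): the odd weights are IRREDUCIBLE iff the orbital operator
  `T₁` has NO eigenvector in `Anti` with a rational eigenvalue (`∀ c, ∀ v ∈ Anti, T₁ v = c·v → v = 0`).  (⟹: an
  eigenspace is stable, so `T₁` would be a scalar on `Anti`, contradicting the independence of `P, T₁` on `Anti` —
  `δ_{x₀} − δ_{ρx₀}` separates them; ⟸: the equivariant projection onto a proper stable `W` (F5) is `aP + bT₁` with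
  `b ≠ 0`, making `W` an eigenspace.)  On a Galois model this is a finite computation (the quadratic minimal
  polynomial of `T₁|_{Anti}` has no rational root).

## References

* [Wielandt1964] H. Wielandt, *Finite Permutation Groups* (1964), Thm. 28.4 and §29 (centraliser algebra, orbitals).
* [Serre1977] J.-P. Serre, *Linear Representations of Finite Groups*, GTM 42 (1977), §1.3 Thm. 1, §2.2 Prop. 4.
* [Mai1989] L. Mai, *Lower bounds for the ranks of CM types*, J. Number Theory 32 (1989), §2 Prop. 1 (proof).
-/

set_option autoImplicit false

noncomputable section

open scoped BigOperators

universe u v w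

namespace Summit.HodgeConjecture.CorCM.IrrOdd

open Literature.NumberTheory.ComplexMultiplication

variable {G : Type w} [Group G] {I : Type u} {X : Type v} [MulAction G X]

open scoped Classical

/-! ### §1 Wielandt's expansion -/

section Expansion

variable [Fintype X] {ρ : G}

omit [Fintype X] in
/-- Translating `δ_{x₀}` by `g` gives `δ_{g x₀}`: `δ_{x₀}(g⁻¹ z) = δ_{g x₀}(z)`. [folklore] -/
theorem single_inv_smul (g : G) (x₀ : X) :
    (fun z => (fun y => if y = x₀ then (1 : ℚ) else 0) (g⁻¹ • z)) = fun z => if z = g • x₀ then (1 : ℚ) else 0 := by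
  funext z
  simp only [inv_smul_eq_iff]

/-- **WIELANDT'S EXPANSION for the odd weights.**  `G` transitive on `X`, `ρ` a central fixed-point-free involution,
`y_1, …, y_p ∉ {x₀, ρx₀}` representatives of `p` different non-self-conjugate orbit pairs of `Stab(x₀)` covering, with
the self-conjugate orbits, all of `X ∖ {x₀, ρx₀}`; `T_j` the orbital operators.  Then every `G`-equivariant
endomorphism `S` of `ℚ^X` with `ρ`-odd values is `S = c₀·(f ↦ f − f∘ρ) + Σ_j c_j·T_j`. [cite: Wielandt1964, Thm. 28.4]
[cite: Serre1977, §2.2 Prop. 4] -/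
theorem exists_coeffs_of_odd_equivariant [MulAction.IsPretransitive G X]
    (hc : ∀ (g : G) (x : X), g • ρ • x = ρ • g • x) (hi : ∀ x : X, ρ • ρ • x = x) (hρ : ∀ x : X, ρ • x ≠ x)
    {p : ℕ} {x₀ : X} (y : Fin p → X) (hy₀ : ∀ j, y j ≠ x₀) (hy₀' : ∀ j, y j ≠ ρ • x₀)
    (hncs : ∀ j (g : G), g • x₀ = x₀ → g • y j ≠ ρ • y j)
    (hsep : ∀ j k, j ≠ k → ∀ g : G, g • x₀ = x₀ → g • y j ≠ y k ∧ g • y j ≠ ρ • y k)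
    (hcover : ∀ x : X, x ≠ x₀ → x ≠ ρ • x₀ →
      (∃ g : G, g • x₀ = x₀ ∧ g • x = ρ • x) ∨ ∃ (j : Fin p) (g : G), g • x₀ = x₀ ∧ (g • y j = x ∨ g • y j = ρ • x))
    (T : Fin p → ((X → ℚ) →ₗ[ℚ] (X → ℚ)))
    (hT : ∀ j (g : G) (f : X → ℚ), T j (fun x => f (g⁻¹ • x)) = fun x => T j f (g⁻¹ • x))
    (hTodd : ∀ j (f : X → ℚ) (x : X), T j f (ρ • x) = -T j f x)
    (hTδ : ∀ j (z : X), T j (fun y' => if y' = x₀ then (1 : ℚ) else 0) z =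
      (if ∃ g : G, g • x₀ = x₀ ∧ g • y j = z then (1 : ℚ) else 0) -
        if ∃ g : G, g • x₀ = x₀ ∧ g • y j = ρ • z then (1 : ℚ) else 0)
    (S : (X → ℚ) →ₗ[ℚ] (X → ℚ)) (hS : ∀ (g : G) (f : X → ℚ), S (fun x => f (g⁻¹ • x)) = fun x => S f (g⁻¹ • x))
    (hSodd : ∀ (f : X → ℚ) (x : X), S f (ρ • x) = -S f x) :
    ∃ (c₀ : ℚ) (c : Fin p → ℚ), ∀ f : X → ℚ,
      S f = c₀ • (fun x => f x - f (ρ • x)) + ∑ j, c j • T j f := by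
  -- notation: `δ₀`, `P`, the candidate `S' = c₀ P + Σ c_j T_j`
  let δ₀ : X → ℚ := fun y' => if y' = x₀ then 1 else 0
  let P : (X → ℚ) →ₗ[ℚ] (X → ℚ) := LinearMap.id - LinearMap.funLeft ℚ ℚ fun x : X => ρ • x
  have hP : ∀ f, P f = fun x => f x - f (ρ • x) := fun f => rfl
  have hPeq : ∀ (g : G) (f : X → ℚ), P (fun x => f (g⁻¹ • x)) = fun x => P f (g⁻¹ • x) := fun g f => by
    rw [hP, hP]
    funext x
    simp only [hc]
  let c₀ : ℚ := S δ₀ x₀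
  let c : Fin p → ℚ := fun j => S δ₀ (y j)
  let S' : (X → ℚ) →ₗ[ℚ] (X → ℚ) := c₀ • P + ∑ j, c j • T j
  have hS'app : ∀ f, S' f = c₀ • (fun x => f x - f (ρ • x)) + ∑ j, c j • T j f := fun f => by
    simp only [S', LinearMap.add_apply, LinearMap.smul_apply, LinearMap.sum_apply, hP]
  have hS'pt : ∀ f z, S' f z = c₀ * (f z - f (ρ • z)) + ∑ j, c j * T j f z := fun f z => by
    rw [hS'app]
    simp only [Pi.add_apply, Pi.smul_apply, Finset.sum_apply, smul_eq_mul]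
  have hS'eq : ∀ (g : G) (f : X → ℚ), S' (fun x => f (g⁻¹ • x)) = fun x => S' f (g⁻¹ • x) := fun g f => by
    simp only [S', LinearMap.add_apply, LinearMap.smul_apply, LinearMap.sum_apply, hPeq g f, hT _ g f]
    funext x
    simp only [Pi.add_apply, Pi.smul_apply, Finset.sum_apply]
  have hS'odd : ∀ (f : X → ℚ) (z : X), S' f (ρ • z) = -S' f z := fun f z => by
    rw [hS'pt, hS'pt, hi]
    simp only [hTodd, mul_neg, Finset.sum_neg_distrib]
    ring
  -- `F = S δ₀` is `Stab(x₀)`-invariant and odd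
  have hFst : ∀ g : G, g • x₀ = x₀ → ∀ z, S δ₀ (g • z) = S δ₀ z := by
    intro g hg z
    have hgx : g⁻¹ • x₀ = x₀ := by rw [inv_smul_eq_iff, hg]
    have hδ : (fun x => δ₀ (g • x)) = δ₀ := by
      funext x
      simp only [δ₀, smul_eq_iff_eq_inv_smul, hgx]
    have h1 := hS g⁻¹ δ₀
    simp only [inv_inv] at h1
    rw [hδ] at h1
    exact (congrFun h1 z).symm
  -- values of `δ₀` and of the orbital pieces
  have hδ₀0 : δ₀ x₀ = 1 := if_pos rfl
  have hδ₀ρ : δ₀ (ρ • x₀) = 0 := if_neg (hρ x₀)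
  have hδ₀off : ∀ z, z ≠ x₀ → z ≠ ρ • x₀ → δ₀ z = 0 ∧ δ₀ (ρ • z) = 0 := fun z hz hz' =>
    ⟨if_neg hz, if_neg fun h => hz' (by rw [← h, hi])⟩
  have hT0 : ∀ j, T j δ₀ x₀ = 0 := fun j => by
    rw [hTδ]
    have h1 : ¬ ∃ g : G, g • x₀ = x₀ ∧ g • y j = x₀ := by
      rintro ⟨g, hg₀, hgy⟩
      exact hy₀ j (smul_left_cancel g (hgy.trans hg₀.symm))
    have h2 : ¬ ∃ g : G, g • x₀ = x₀ ∧ g • y j = ρ • x₀ := by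
      rintro ⟨g, hg₀, hgy⟩
      refine hy₀' j (smul_left_cancel g ?_)
      rw [hgy, hc, hg₀]
    rw [if_neg h1, if_neg h2, sub_zero]
  have hTk : ∀ j k (g : G), g • x₀ = x₀ → T j δ₀ (g • y k) = if j = k then 1 else 0 := by
    intro j k g hg
    rw [hTδ]
    by_cases hjk : j = k
    · subst hjk
      rw [if_pos ⟨g, hg, rfl⟩, if_neg, if_pos rfl, sub_zero]
      rintro ⟨g', hg', hgy⟩
      refine hncs j (g⁻¹ * g') (by rw [mul_smul, hg', inv_smul_eq_iff, hg]) ?_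
      rw [mul_smul, hgy, ← hc, inv_smul_smul]
    · rw [if_neg, if_neg, if_neg hjk, sub_zero]
      · rintro ⟨g', hg', hgy⟩
        refine (hsep j k hjk (g⁻¹ * g') (by rw [mul_smul, hg', inv_smul_eq_iff, hg])).2 ?_
        rw [mul_smul, hgy, ← hc, inv_smul_smul]
      · rintro ⟨g', hg', hgy⟩
        refine (hsep j k hjk (g⁻¹ * g') (by rw [mul_smul, hg', inv_smul_eq_iff, hg])).1 ?_
        rw [mul_smul, hgy, inv_smul_smul]
  have hTsc : ∀ j (z : X) (g : G), g • x₀ = x₀ → g • z = ρ • z → T j δ₀ z = 0 := by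
    intro j z g hg hgz
    rw [hTδ, if_neg, if_neg, sub_zero]
    · rintro ⟨g', hg', hgy⟩
      refine hncs j (g'⁻¹ * (g * g')) (by rw [mul_smul, mul_smul, hg', hg, inv_smul_eq_iff, hg']) ?_
      rw [mul_smul, mul_smul, hgy, hc, hgz, hi, (eq_inv_smul_iff).2 hgy, ← hc g'⁻¹ (ρ • z), hi]
    · rintro ⟨g', hg', hgy⟩
      refine hncs j (g'⁻¹ * (g * g')) (by rw [mul_smul, mul_smul, hg', hg, inv_smul_eq_iff, hg']) ?_
      rw [mul_smul, mul_smul, hgy, hgz, hc, ← hgy, inv_smul_smul]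
  -- the identity `S δ₀ = S' δ₀`, pointwise
  have hbase0 : S δ₀ x₀ = S' δ₀ x₀ := by
    rw [hS'pt, hδ₀0, hδ₀ρ]
    simp only [hT0, mul_zero, Finset.sum_const_zero]
    change S δ₀ x₀ = S δ₀ x₀ * (1 - 0) + 0
    ring
  have hbasek : ∀ k (g : G), g • x₀ = x₀ → S δ₀ (g • y k) = S' δ₀ (g • y k) := by
    intro k g hg
    have h1 : g • y k ≠ x₀ := fun h => hy₀ k (smul_left_cancel g (h.trans hg.symm))
    have h2 : g • y k ≠ ρ • x₀ := fun h => hy₀' k (smul_left_cancel g (by rw [h, hc, hg]))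
    rw [hFst g hg, hS'pt, (hδ₀off _ h1 h2).1, (hδ₀off _ h1 h2).2]
    simp only [hTk _ k g hg, mul_ite, mul_one, mul_zero, Finset.sum_ite_eq', Finset.mem_univ, if_true]
    change S δ₀ (y k) = c₀ * (0 - 0) + S δ₀ (y k)
    ring
  have hFR : S δ₀ = S' δ₀ := by
    funext z
    by_cases hz : z = x₀
    · rw [hz]; exact hbase0
    by_cases hz' : z = ρ • x₀
    · rw [hz', hSodd, hS'odd, hbase0]
    rcases hcover z hz hz' with ⟨g, hg, hgz⟩ | ⟨k, g, hg, hgk | hgk⟩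
    · -- self-conjugate orbit: both sides vanish
      have hF : S δ₀ z = 0 := by
        have h1 := hFst g hg z
        rw [hgz, hSodd] at h1
        linarith
      rw [hF, hS'pt, (hδ₀off z hz hz').1, (hδ₀off z hz hz').2]
      simp only [hTsc _ z g hg hgz, mul_zero, Finset.sum_const_zero, sub_zero, add_zero]
    · rw [← hgk]; exact hbasek k g hg
    · have hz2 : z = ρ • g • y k := by rw [hgk, hi]
      rw [hz2, hSodd, hS'odd, hbasek k g hg]
  -- from `δ₀` to every `δ_y`, then to every `f`
  have hSS' : S = S' := by
    refine LinearMap.pi_ext fun y' a => ?_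
    obtain ⟨g, hg⟩ := MulAction.exists_smul_eq G x₀ y'
    have hδ : (Pi.single y' a : X → ℚ) = a • fun z => δ₀ (g⁻¹ • z) := by
      funext z
      simp only [δ₀, Pi.single_apply, Pi.smul_apply, smul_eq_mul, mul_ite, mul_one, mul_zero, inv_smul_eq_iff, hg]
    rw [hδ, map_smul, map_smul, hS g δ₀, hS'eq g δ₀, hFR]
  exact ⟨c₀, c, fun f => by rw [← hS'app, ← hSS']⟩

end Expansion

/-! ### §2 One non-self-conjugate orbit pair: (IRR) ⟺ no rational eigenvector of the orbital operator -/

section OnePair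

variable {ρ : G}

/-- **`P` and `T₁` are independent on `Anti`** (explicit form for ONE orbital operator): if `a·P v + b·T₁ v = 0` for
all odd `v`, then `a = b = 0` — evaluate at `δ_{x₀} − δ_{ρx₀}`, at the points `x₀` and `y₁`.
[cite: Wielandt1964, Thm. 28.4] -/
theorem eq_zero_of_smul_add_smul_orbital_eq_zero (hc : ∀ (g : G) (x : X), g • ρ • x = ρ • g • x)
    (hi : ∀ x : X, ρ • ρ • x = x) (hρ : ∀ x : X, ρ • x ≠ x) {x₀ y₁ : X} (hy₀ : y₁ ≠ x₀) (hy₀' : y₁ ≠ ρ • x₀)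
    (hncs : ∀ g : G, g • x₀ = x₀ → g • y₁ ≠ ρ • y₁)
    (T₁ : (X → ℚ) →ₗ[ℚ] (X → ℚ))
    (hT : ∀ (g : G) (f : X → ℚ), T₁ (fun x => f (g⁻¹ • x)) = fun x => T₁ f (g⁻¹ • x))
    (hTodd : ∀ (f : X → ℚ) (x : X), T₁ f (ρ • x) = -T₁ f x)
    (hTδ : ∀ z : X, T₁ (fun y' => if y' = x₀ then (1 : ℚ) else 0) z =
      (if ∃ g : G, g • x₀ = x₀ ∧ g • y₁ = z then (1 : ℚ) else 0) -
        if ∃ g : G, g • x₀ = x₀ ∧ g • y₁ = ρ • z then (1 : ℚ) else 0)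
    {a b : ℚ} (hab : ∀ v ∈ antiWeights (E := X) ρ, a • (fun x => v x - v (ρ • x)) + b • T₁ v = 0) :
    a = 0 ∧ b = 0 := by
  let δ₀ : X → ℚ := fun y' => if y' = x₀ then 1 else 0
  let δ₁ : X → ℚ := fun y' => if y' = ρ • x₀ then 1 else 0
  have hmemA : ∀ f : X → ℚ, f ∈ antiWeights (E := X) ρ ↔ ∀ x, f (ρ • x) = -f x := fun f => Iff.rfl
  have hu : (δ₀ - δ₁ : X → ℚ) ∈ antiWeights (E := X) ρ := by
    rw [hmemA]
    intro x
    have h1 : (ρ • x = x₀) ↔ x = ρ • x₀ := ⟨fun h => by rw [← h, hi], fun h => by rw [h, hi]⟩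
    have h2 : (ρ • x = ρ • x₀) ↔ x = x₀ := ⟨fun h => by simpa only [hi] using congrArg (ρ • ·) h,
      fun h => by rw [h]⟩
    simp only [Pi.sub_apply, δ₀, δ₁, h1, h2]
    ring
  have h := hab _ hu
  have hT2 : T₁ (δ₀ - δ₁) = (2 : ℚ) • T₁ δ₀ := apply_single_sub_single_rho hi T₁ hT hTodd x₀
  rw [hT2] at h
  -- evaluate at `x₀` and at `y₁`
  have hT0 : T₁ δ₀ x₀ = 0 := by
    rw [hTδ]
    have h1 : ¬ ∃ g : G, g • x₀ = x₀ ∧ g • y₁ = x₀ := by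
      rintro ⟨g, hg₀, hgy⟩
      exact hy₀ (smul_left_cancel g (hgy.trans hg₀.symm))
    have h2 : ¬ ∃ g : G, g • x₀ = x₀ ∧ g • y₁ = ρ • x₀ := by
      rintro ⟨g, hg₀, hgy⟩
      refine hy₀' (smul_left_cancel g ?_)
      rw [hgy, hc, hg₀]
    rw [if_neg h1, if_neg h2, sub_zero]
  have hTy : T₁ δ₀ y₁ = 1 := by
    rw [hTδ, if_pos ⟨1, one_smul G x₀, one_smul G y₁⟩, if_neg, sub_zero]
    rintro ⟨g, hg, hgy⟩
    exact hncs g hg hgy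
  have hx := congrFun h x₀
  have hy := congrFun h y₁
  have hρy : ¬ ρ • y₁ = x₀ := fun h' => hy₀' (by rw [← h', hi])
  have hρy' : ¬ ρ • y₁ = ρ • x₀ := fun h' => hy₀ (by simpa only [hi] using congrArg (ρ • ·) h')
  simp only [Pi.add_apply, Pi.smul_apply, Pi.sub_apply, Pi.zero_apply, smul_eq_mul, δ₀, δ₁, if_true,
    if_neg (hρ x₀), if_neg (Ne.symm (hρ x₀)), hT0, if_neg hy₀, if_neg hy₀', hρy, hρy', if_false, hTy] at hx hy
  constructor <;> linarith

variable [Fintype X]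

/-- **ONE NON-SELF-CONJUGATE ORBIT PAIR: (IRR) ⟺ THE ORBITAL OPERATOR HAS NO RATIONAL EIGENVECTOR IN `Anti`.**
`G` transitive, `ρ` central fixed-point-free involution, `y₁ ∉ {x₀, ρx₀}` with (SC) failing at `(x₀, y₁)`, every other
point of `X ∖ {x₀, ρx₀}` in a self-conjugate orbit or in the orbit pair of `y₁`, `T₁` the orbital operator of
`(x₀, y₁)`.  Then the `ρ`-odd weights are irreducible iff `T₁ v = c·v`, `v` odd, forces `v = 0` (for every `c ∈ ℚ`).
[cite: Wielandt1964, Thm. 28.4] [cite: Serre1977, §1.3 Thm. 1 and §2.2 Prop. 4] -/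
theorem irreducible_iff_forall_eigen [MulAction.IsPretransitive G X]
    (hc : ∀ (g : G) (x : X), g • ρ • x = ρ • g • x) (hi : ∀ x : X, ρ • ρ • x = x) (hρ : ∀ x : X, ρ • x ≠ x)
    {x₀ y₁ : X} (hy₀ : y₁ ≠ x₀) (hy₀' : y₁ ≠ ρ • x₀) (hncs : ∀ g : G, g • x₀ = x₀ → g • y₁ ≠ ρ • y₁)
    (hcover : ∀ x : X, x ≠ x₀ → x ≠ ρ • x₀ →
      (∃ g : G, g • x₀ = x₀ ∧ g • x = ρ • x) ∨ ∃ g : G, g • x₀ = x₀ ∧ (g • y₁ = x ∨ g • y₁ = ρ • x))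
    (T₁ : (X → ℚ) →ₗ[ℚ] (X → ℚ))
    (hT : ∀ (g : G) (f : X → ℚ), T₁ (fun x => f (g⁻¹ • x)) = fun x => T₁ f (g⁻¹ • x))
    (hTodd : ∀ (f : X → ℚ) (x : X), T₁ f (ρ • x) = -T₁ f x)
    (hTδ : ∀ z : X, T₁ (fun y' => if y' = x₀ then (1 : ℚ) else 0) z =
      (if ∃ g : G, g • x₀ = x₀ ∧ g • y₁ = z then (1 : ℚ) else 0) -
        if ∃ g : G, g • x₀ = x₀ ∧ g • y₁ = ρ • z then (1 : ℚ) else 0) :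
    (∀ W : Submodule ℚ (X → ℚ), W ≤ antiWeights (E := X) ρ → W ≠ ⊥ →
      (∀ (k : G) (f : X → ℚ), f ∈ W → (fun y => f (k • y)) ∈ W) → W = antiWeights (E := X) ρ) ↔
    ∀ (a : ℚ) (v : X → ℚ), v ∈ antiWeights (E := X) ρ → T₁ v = a • v → v = 0 := by
  have hmemA : ∀ f : X → ℚ, f ∈ antiWeights (E := X) ρ ↔ ∀ x, f (ρ • x) = -f x := fun f => Iff.rfl
  have hAst : ∀ (k : G) (f : X → ℚ), f ∈ antiWeights (E := X) ρ → (fun x => f (k • x)) ∈ antiWeights (E := X) ρ :=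
    comp_smul_mem_antiWeights hc
  constructor
  · -- (IRR) ⟹ no eigenvector: the eigenspace is stable, hence all of `Anti`, so `T₁ = a` on `Anti` — but `P, T₁`
    -- are independent there
    intro hirr a v hv hTv
    by_contra hv0
    let L : (X → ℚ) →ₗ[ℚ] (X → ℚ) := T₁ - a • (LinearMap.id : (X → ℚ) →ₗ[ℚ] (X → ℚ))
    have hL : ∀ f, L f = T₁ f - a • f := fun f => rfl
    let W : Submodule ℚ (X → ℚ) := antiWeights (E := X) ρ ⊓ LinearMap.ker L
    have hmemW : ∀ f, f ∈ W ↔ f ∈ antiWeights (E := X) ρ ∧ T₁ f = a • f := fun f => by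
      change f ∈ antiWeights (E := X) ρ ⊓ LinearMap.ker L ↔ _
      rw [Submodule.mem_inf, LinearMap.mem_ker, hL, sub_eq_zero]
    have hWst : ∀ (k : G) (f : X → ℚ), f ∈ W → (fun y => f (k • y)) ∈ W := by
      intro k f hf
      rw [hmemW] at hf ⊢
      refine ⟨hAst k f hf.1, ?_⟩
      have h2 := hT k⁻¹ f
      rw [inv_inv] at h2
      rw [h2, hf.2]
      rfl
    have hvW : v ∈ W := (hmemW v).2 ⟨hv, hTv⟩
    have hW : W = antiWeights (E := X) ρ := hirr W inf_le_left (fun h => hv0 (by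
      rw [h] at hvW
      exact (Submodule.mem_bot ℚ).1 hvW)) hWst
    -- so `T₁ w = a w` for every odd `w`: `(−a/2)·P + 1·T₁ = 0` on `Anti`
    have hall : ∀ w ∈ antiWeights (E := X) ρ, (-(a / 2)) • (fun x => w x - w (ρ • x)) + (1 : ℚ) • T₁ w = 0 := by
      intro w hw
      have hw' : w ∈ W := by rw [hW]; exact hw
      have h1 : T₁ w = a • w := ((hmemW w).1 hw').2
      rw [h1, one_smul]
      funext x
      simp only [Pi.add_apply, Pi.smul_apply, smul_eq_mul, (hmemA w).1 hw x, Pi.zero_apply]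
      ring
    have h := (eq_zero_of_smul_add_smul_orbital_eq_zero hc hi hρ hy₀ hy₀' hncs T₁ hT hTodd hTδ hall).2
    exact one_ne_zero h
  · -- no eigenvector ⟹ (IRR): the equivariant projection onto a proper stable `W` is `c₀P + c₁T₁` with `c₁ ≠ 0`
    intro heig W hWA hW0 hWst
    by_contra hWne
    obtain ⟨Q, hQ, hQW, hQid⟩ := exists_equivariant_projection (G := G) W hWst
    have hQodd : ∀ (f : X → ℚ) (x : X), Q f (ρ • x) = -Q f x := fun f x => (hmemA _).1 (hWA (hQW f)) x
    obtain ⟨c₀, c, hQexp⟩ := exists_coeffs_of_odd_equivariant hc hi hρ (fun _ : Fin 1 => y₁) (fun _ => hy₀)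
      (fun _ => hy₀') (fun _ => hncs) (fun j k hjk => absurd (Subsingleton.elim j k) hjk)
      (fun x hx hx' => (hcover x hx hx').imp_right fun ⟨g, hg, hgx⟩ => ⟨0, g, hg, hgx⟩)
      (fun _ => T₁) (fun _ => hT) (fun _ => hTodd) (fun _ => hTδ) Q hQ hQodd
    -- `w ∈ W`, `w ≠ 0`: `w = Q w = 2c₀ w + c₁ T₁ w`
    obtain ⟨w, hw, hw0⟩ := (Submodule.ne_bot_iff W).1 hW0
    have hwA := hWA hw
    have hQw : Q w = (2 * c₀) • w + c 0 • T₁ w := by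
      rw [hQexp w, Fin.sum_univ_one]
      congr 1
      funext x
      simp only [Pi.smul_apply, smul_eq_mul, (hmemA w).1 hwA x]
      ring
    rw [hQid w hw] at hQw
    by_cases hc1 : c 0 = 0
    · -- `c₁ = 0`: `Q = c₀ P` is `2c₀` on `Anti`, so `2c₀ = 1` and `Q` fixes `Anti`: `W = Anti`
      apply hWne
      refine le_antisymm hWA fun a ha => ?_
      have h20 : 2 * c₀ = 1 := by
        rw [hc1, zero_smul, add_zero] at hQw
        by_contra h21
        apply hw0
        have h3 : (1 - 2 * c₀) • w = 0 := by rw [sub_smul, one_smul, ← hQw, sub_self]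
        exact (smul_eq_zero.1 h3).resolve_left (sub_ne_zero.2 (Ne.symm h21))
      have hQa : Q a = a := by
        rw [hQexp a, Fin.sum_univ_one, hc1, zero_smul, add_zero]
        funext x
        simp only [Pi.smul_apply, smul_eq_mul, (hmemA a).1 ha x]
        linear_combination a x * h20
      rw [← hQa]
      exact hQW a
    · -- `c₁ ≠ 0`: `w` is an eigenvector of `T₁`
      have hTw : T₁ w = ((1 - 2 * c₀) / c 0) • w := by
        have h1 : c 0 • T₁ w = (1 - 2 * c₀) • w := by
          rw [sub_smul, one_smul]
          exact eq_sub_of_add_eq' hQw.symm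
        calc T₁ w = (c 0)⁻¹ • (c 0 • T₁ w) := by rw [smul_smul, inv_mul_cancel₀ hc1, one_smul]
          _ = ((1 - 2 * c₀) / c 0) • w := by rw [h1, smul_smul, div_eq_inv_mul]
      exact hw0 (heig _ w hwA hTw)

end OnePair

end Summit.HodgeConjecture.CorCM.IrrOdd

end
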